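import Summits.ABC.IUTFork.Cor312TwoPlacePins
import Summits.ABC.IUTFork.Repair.CandJoshi21
import Summits.ABC.IUTFork.Repair.CandDupuyHilado2
import HarnessLib

/-!
# IUT REPAIR branch (rung LADDER-ABC:A2.RP) — the «2P» COLUMN, part 5 (seat abc-iut-rp-m4): Joshi (B3) and Dupuy–Hilado (B4) rows at the
# pinned two-place bed

Record file of the abc-iut cell's REPAIR branch (seat abc-iut-rp-m4; lead abc-iut-rp-plan). TAKES NO SIDE on [IUTchIII] Cor. 3.12 or on any
author (Mochizuki, Joshi, Dupuy–Hilado, Scholze–Stix); PROOF-ONLY; every hypothesis evaluated is a typed CANDIDATE of its record file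
(`Repair/CandJoshi21` rp-j2 p427435; `Repair/CandDupuyHilado2` rp-h2), never asserted. Bed: `Cor312TwoPlacePins` (p434789; two places,
inflation `(0, 3)`, honest q-datum, one region operator `rho2`, three pins, typed Thm. 3.11, bridge hypotheses, `|log(q)| > 0`; Statement TRUE,
S / Licence FALSE). Cells: ✗ J21-1 `JoshiAnsatzQReading` · ✗ J21-2 `JoshiScalingIndeterminacy` · ✗ J21-3 `JoshiTopNormalized` · ✗ J21-4
`JoshiLocalPrototype` (packetwise volume) · ✗ J21-5 `JoshiNonIsometricIndeterminacy` (EMPTY on this isometric bed: the (Ind1),(Ind2)-group fixes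
every cylinder) · ✗ RP-H02b `CandDupuyHilado2.H'` (≡ `GapH3` on pinned settings) · ✗ RP-H02c `∃ X, CandDupuyHilado2.H'' X` (≡ C). READING (neutral):
the (LcGlIq)/(EssGlIq) split of S. Mochizuki's [Rpt2024-03] `paper:url-b58939b9dc8f` p. 7 l. 32–44, continued: every packetwise B3/B4 row
fails where the typed Corollary holds. Standard axioms only. [claim: Mochizuki2012, status: disputed]
-/

noncomputable section

open Set

namespace Summit.ABC.IUTFork.Repair.TwoPlaceProfile5

open Thm311 Cor312 Cor312Vol Cor312Vol.TwoPlace Cor312Vol.NaiveProv Literature.IUT.LogThetaLattice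

variable (p : ℕ) [hp : Fact p.Prime] (c : ℝ)

/-! ## 1. Joshi rows (B3, `CandJoshi21`) -/

/-- ✗ **J21-3** (`JoshiTopNormalized`: `ρ qK ⊆ ρ Ψ_n` packetwise ⟹ hull form ⟹ Licence): FALSE at 2P. [folklore] -/
theorem J21_3_fails :
    ¬ JoshiTopNormalized (twoFull p c).toLatticeSituation (twoSetting p c depth) (rho2 p depth) (qDatum p (0 : twoIndex.V) trivial c) :=
  fun h => two_not_licence p c
    (licence_of_pilotKummerCompatHull _ _ _ _ (two_pinnedRegions3 p c depth).1.2
      (pilotKummerCompatHull_of_topNormalized _ _ _ _ (two_kummerB p c _) (two_pinnedRegions3 p c depth).1.1 h))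

/-- ✗ **J21-1** (`JoshiAnsatzQReading`: `ρ qK = ρ Ψ_n`, the identity-indeterminacy residual): FALSE at 2P. [folklore] -/
theorem J21_1_fails :
    ¬ JoshiAnsatzQReading (twoFull p c).toLatticeSituation (twoSetting p c depth) (rho2 p depth) (qDatum p (0 : twoIndex.V) trivial c) :=
  fun h => two_pinned_not_S p c (pilotKummerIndRelated_of_ansatzQReading _ _ _ _ h)

/-- ✗ **J21-2** (`JoshiScalingIndeterminacy`: a member of ⟨(Ind1) ∪ (Ind2)⟩ carries `Ψ_n` onto `qK` ≡ C): FALSE at 2P. [folklore] -/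
theorem J21_2_fails :
    ¬ JoshiScalingIndeterminacy (twoFull p c).toLatticeSituation (twoSetting p c depth) (qDatum p (0 : twoIndex.V) trivial c) :=
  fun h => two_pinned_not_S p c (pilotKummerIndRelated_of_scalingIndeterminacy _ _ (rho2 p depth) _ h)

/-- ✗ **J21-4** (`JoshiLocalPrototype`: the PACKETWISE volume comparison = Reading 0): FALSE at 2P — deep place `0`, label `2`: `−c ≤ −4c`
fails (`c > 0`). [folklore] -/
theorem J21_4_fails (hc : 0 < c) : ¬ JoshiLocalPrototype (twoSetting p c depth) := by
  intro h
  have h1 := h 1 0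
  rw [two_qLocal, two_thetaLocal, WithTop.untopD_coe, two_jsq.2, depth_val.1] at h1
  push_cast at h1
  linarith

omit hp in
/-- ✗ **J21-5** (`JoshiNonIsometricIndeterminacy`: some member of ⟨(Ind1) ∪ (Ind2)⟩ changes the log-volume of an admissible region): FALSE at
the two-place model — the group acts by signs and FIXES every cylinder (the admissible regions), at EVERY column `n`. (EMPTY on isometric beds,
as at the CM.) [folklore] -/
theorem J21_5_fails (n : ℤ) : ¬ JoshiNonIsometricIndeterminacy (twoFull p c).toLatticeSituation.toSituation n := by
  rintro ⟨Φ, hΦ, j, vQ, A, ⟨k, rfl⟩, hne⟩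
  exact hne (by rw [image_pBall_of_mem_closure p hΦ j vQ k])

/-! ## 2. Dupuy–Hilado rows (B4, `CandDupuyHilado2`) -/

/-- ✗ **RP-H02b** (`CandDupuyHilado2.H'`: link pin ⟹ Licence, ≡ `GapH3` on pinned settings): FALSE at 2P. [folklore] -/
theorem H02b_fails : ¬ CandDupuyHilado2.H' (twoFull p c).toLatticeSituation (twoSetting p c depth) :=
  fun h => two_pinned_not_gapH3 p c ((CandDupuyHilado2.H'_iff_gapH3 _ _ (rho2 p depth) (qDatum p (0 : twoIndex.V) trivial c)
    (two_pinnedRegions3 p c depth).1).1 h)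

/-- ✗ **RP-H02c** (`∃ X, CandDupuyHilado2.H'' X`: DH's strip-transport interpretation at the pilots ≡ C): FALSE at 2P. [folklore] -/
theorem H02c_fails :
    ¬ ∃ X : CandDupuyHilado2.StripTransport (twoFull p c).toLatticeSituation,
      CandDupuyHilado2.H'' (twoFull p c).toLatticeSituation (twoSetting p c depth) (qDatum p (0 : twoIndex.V) trivial c) X :=
  fun h => two_pinned_not_S p c (pilotKummerIndRelated_of_pilotKummerCompat _ _ (rho2 p depth) _ (two_kummerB p c _)
    ((CandDupuyHilado2.exists_H''_iff_pilotKummerCompat _ _ _).1 h))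

/-- **Part 5 of the column, packaged** (`c = log p`). [folklore] -/
theorem twoPlace_column5 :
    ¬ JoshiAnsatzQReading (twoFull p (Real.log p)).toLatticeSituation (twoSetting p (Real.log p) depth) (rho2 p depth)
        (qDatum p (0 : twoIndex.V) trivial (Real.log p)) ∧
      ¬ JoshiScalingIndeterminacy (twoFull p (Real.log p)).toLatticeSituation (twoSetting p (Real.log p) depth)
        (qDatum p (0 : twoIndex.V) trivial (Real.log p)) ∧
      ¬ JoshiTopNormalized (twoFull p (Real.log p)).toLatticeSituation (twoSetting p (Real.log p) depth) (rho2 p depth)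
        (qDatum p (0 : twoIndex.V) trivial (Real.log p)) ∧
      ¬ JoshiLocalPrototype (twoSetting p (Real.log p) depth) ∧
      ¬ JoshiNonIsometricIndeterminacy (twoFull p (Real.log p)).toLatticeSituation.toSituation 0 ∧
      ¬ CandDupuyHilado2.H' (twoFull p (Real.log p)).toLatticeSituation (twoSetting p (Real.log p) depth) ∧
      ¬ ∃ X : CandDupuyHilado2.StripTransport (twoFull p (Real.log p)).toLatticeSituation,
        CandDupuyHilado2.H'' (twoFull p (Real.log p)).toLatticeSituation (twoSetting p (Real.log p) depth)
          (qDatum p (0 : twoIndex.V) trivial (Real.log p)) X :=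
  have hc : 0 < Real.log p := Real.log_pos (by exact_mod_cast hp.out.one_lt)
  ⟨J21_1_fails p _, J21_2_fails p _, J21_3_fails p _, J21_4_fails p _ hc, J21_5_fails p _ 0, H02b_fails p _, H02c_fails p _⟩

end Summit.ABC.IUTFork.Repair.TwoPlaceProfile5

end
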